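import Literature.AlgebraicGeometry.Frobenioids.DivisorMonoidCategoryTheoreticityDefs
import Mathlib.Algebra.Order.Archimedean.Basic
import Mathlib.Data.NNRat.Order
import HarnessLib

/-!
# Frobenioids I, §4 Prop. 4.1 as SCHEMATA — preliminaries: one-object pre-Frobenioid DATA over a
# `ℚ_{≥0}`-cone (typology of Def. 1.2) and primary elements of `ℚ_{≥0}²`

Mochizuki, *The geometry of Frobenioids I: the general theory*, Kyushu J. Math. **62** (2008) 293–400,
§0 p. 12 (primary elements, primes), Def. 1.1 (iii)/(iv) pp. 20–21, Def. 1.2 pp. 21–23, Prop. 4.1 p. 75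
[cite: MochizukiFrdI2008, Def. 1.2 p.21].

PROOF-ONLY file (no definitions, no instances); cell abc-iut, block F, seat abc-iut-f-045 (gen 4).  It is
the shared toolkit of the two companions `Prop41SchemaNegative.lean` (FACT-LIST F-1038 · F-1042 · F-1043)
and `Prop41SchemaNegativeB.lean` (F-1039 · F-1041), which settle the CLOSURE side (R5) of the five rows
`PreFrobenioidData.Prop41i/ii/iii_square/iv/v`: those decls (seat abc-iut-L1-t3,
`DivisorMonoidCategoryTheoreticityDefs.lean`) are conclusion predicates over ARBITRARY operations
`S : PreFrobenioidData C D` (an INTERFACE: `Base`, `Φ`, pull-backs, `Div`, `deg_Fr` with the laws of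
Rem. 1.1.1 — and nothing of Def. 1.3), so their universal closures quantify over non-Frobenioids; the
instances of record `PreFrobenioidData.prop41i_holds … prop41v_holds` (`IsFrobenioid F`, perf-factorial
`Φ`; `DivisorMonoidCategoryTheoreticityProofs.lean`) are untouched.

The countermodels live on the one-object category `SingleObj F_K`, `F_K = ElemFrobenioidMonoid
(Multiplicative K)` the monoid of [FrdI] Def. 1.1 (iii) (`(a₁, n₁)·(a₂, n₂) = (a₁ + n₁ a₂, n₁ n₂)`) over a
`ℚ_{≥0}`-module `K` ("cone"), equipped with ANY operations `S` such that (a) `deg_Fr` is the degree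
component, (b) base maps are isomorphisms, (c) `Div` vanishes exactly when the `K`-component does,
(d) pull-backs along endomorphisms are trivial.  Proved here, for such `S` and sharp `K`:
* `singleObj_isPreStep_iff` / `singleObj_isStep_iff` / `singleObj_isFrobeniusType_iff` — pre-steps =
  degree `1`; steps = degree `1` and `Div ≠ 0`; Frobenius type = `Div = 0` (isometric pre-steps are
  isomorphisms, so co-angularity is automatic);
* `singleObj_isOfIsotropicType`, `singleObj_isOfPerfectType` — isotropic and PERFECT type (`(0, n)` is
  of Frobenius type of degree `n`; a pre-step `(a, 1)` lifts uniquely to `(n⁻¹ a, 1)`);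
* `singleObj_exists_prop41Setting` — the Prop. 4.1 setting (`A` Div-Frobenius-trivial, `α_n = (0, n)`
  Div-identity of Frobenius type of degree `n`) holds at the unique object;
* `isPrimary_ofAdd_one_zero_nnrat`, `not_isPrimary_ofAdd_nnrat_of_pos` — in `ℚ_{≥0}²`, `(1, 0)` is
  primary and `(x, y)` with `x, y > 0` is not.
Refuted-closure ≠ refuted-paper; a FACT row is an assumption label, not an endorsement; nothing here
bears on [IUTchIII] Cor. 3.12.
-/

namespace Literature.AlgebraicGeometry.Frobenioids

open CategoryTheory

/-! ### `ℚ_{≥0}`-cones: roots and torsion -/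

/-- In a `ℚ_{≥0}`-module, `n · (n⁻¹ · a) = a` for `n ≥ 1`. [folklore] -/
private theorem pnat_nsmul_inv_smul {K : Type*} [AddCommMonoid K] [Module ℚ≥0 K] (n : ℕ+) (a : K) :
    (n : ℕ) • ((n : ℚ≥0)⁻¹ • a) = a := by
  rw [← Nat.cast_smul_eq_nsmul ℚ≥0, smul_smul,
    mul_inv_cancel₀ (by exact_mod_cast n.ne_zero), one_smul]

/-- In a `ℚ_{≥0}`-module, `n⁻¹ · (n · a) = a` for `n ≥ 1`. [folklore] -/
private theorem inv_smul_pnat_nsmul {K : Type*} [AddCommMonoid K] [Module ℚ≥0 K] (n : ℕ+) (a : K) :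
    (n : ℚ≥0)⁻¹ • ((n : ℕ) • a) = a := by
  rw [← Nat.cast_smul_eq_nsmul ℚ≥0, smul_smul,
    inv_mul_cancel₀ (by exact_mod_cast n.ne_zero), one_smul]

/-- A `ℚ_{≥0}`-module has no `N_{≥1}`-torsion. [folklore] -/
private theorem eq_zero_of_pnat_nsmul_eq_zero {K : Type*} [AddCommMonoid K] [Module ℚ≥0 K] (n : ℕ+)
    {a : K} (h : (n : ℕ) • a = 0) : a = 0 := by
  rw [← inv_smul_pnat_nsmul n a, h, smul_zero]

/-! ### Primary elements of `ℚ_{≥0} × ℚ_{≥0}` (written multiplicatively) -/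

/-- `(x, y)` with `x, y > 0` is NOT a primary element of `ℚ_{≥0}²`: `(x, 0) ≼ (x, y)` but
`(x, y) ⋠ (x, 0)`. [cite: MochizukiFrdI2008, §0 p.12] -/
theorem not_isPrimary_ofAdd_nnrat_of_pos {x y : ℚ≥0} (hx : 0 < x) (hy : 0 < y) :
    ¬ IsPrimary (Multiplicative.ofAdd (x, y)) := by
  rintro ⟨-, h⟩
  have hb : Multiplicative.ofAdd (x, (0 : ℚ≥0)) ≠ 1 := by
    rw [Ne, ofAdd_eq_one, Prod.mk_eq_zero]
    exact fun h0 => hx.ne' h0.1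
  have hba : Multiplicative.ofAdd (x, (0 : ℚ≥0)) ≼ Multiplicative.ofAdd (x, y) :=
    ⟨1, one_pos, Multiplicative.ofAdd ((0 : ℚ≥0), y), by
      rw [pow_one, ← ofAdd_add, Prod.mk_add_mk, add_zero, zero_add]⟩
  obtain ⟨m, -, c, hc⟩ := h _ hb hba
  have h2 := congrArg (fun z => (Multiplicative.toAdd z).2) hc
  simp only [toAdd_pow, toAdd_ofAdd, Prod.smul_snd, smul_zero, toAdd_mul, Prod.snd_add] at h2
  exact hy.ne' (add_eq_zero.mp h2.symm).1

/-- `(1, 0)` is a primary element of `ℚ_{≥0}²` (`ℚ_{≥0}` is archimedean).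
[cite: MochizukiFrdI2008, §0 p.12] -/
theorem isPrimary_ofAdd_one_zero_nnrat :
    IsPrimary (Multiplicative.ofAdd ((1 : ℚ≥0), (0 : ℚ≥0))) := by
  refine ⟨?_, fun b hb hba => ?_⟩
  · rw [Ne, ofAdd_eq_one, Prod.mk_eq_zero]
    exact fun h0 => one_ne_zero h0.1
  obtain ⟨n, -, c, hc⟩ := hba
  have h2 := congrArg (fun z => (Multiplicative.toAdd z).2) hc
  simp only [toAdd_pow, toAdd_ofAdd, Prod.smul_snd, smul_zero, toAdd_mul, Prod.snd_add] at h2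
  have hb2 : (Multiplicative.toAdd b).2 = 0 := (add_eq_zero.mp h2.symm).1
  have hb1 : 0 < (Multiplicative.toAdd b).1 := by
    refine pos_iff_ne_zero.mpr fun hb1 => hb ?_
    rw [← ofAdd_toAdd b, ofAdd_eq_one]
    exact Prod.ext hb1 hb2
  obtain ⟨m, hm⟩ := Archimedean.arch (1 : ℚ≥0) hb1
  have hm0 : 0 < m := by
    refine Nat.pos_of_ne_zero ?_
    rintro rfl
    rw [zero_smul] at hm
    exact not_lt.mpr hm zero_lt_one
  refine ⟨m, hm0, Multiplicative.ofAdd ((m • (Multiplicative.toAdd b).1 - 1, (0 : ℚ≥0))), ?_⟩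
  apply Multiplicative.toAdd.injective
  rw [toAdd_pow, toAdd_mul, toAdd_ofAdd, toAdd_ofAdd]
  refine Prod.ext ?_ ?_
  · rw [Prod.smul_fst, Prod.fst_add, add_tsub_cancel_of_le hm]
  · rw [Prod.smul_snd, Prod.snd_add, hb2, smul_zero, add_zero]

/-! ### One-object pre-Frobenioid DATA over a `ℚ_{≥0}`-cone `K`: generic facts

The category is `SingleObj (F_K)`, `F_K = ElemFrobenioidMonoid (Multiplicative K)` the monoid of
[FrdI] Def. 1.1 (iii) (`(a₁, n₁) · (a₂, n₂) = (a₁ + n₁ a₂, n₁ n₂)`); the operations `S` are ANY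
`PreFrobenioidData` on it whose Frobenius degree is the degree component, whose base maps are
isomorphisms, whose zero divisor vanishes exactly when the `K`-component does, and whose pull-backs
along endomorphisms are trivial. -/

section Generic

variable {K : Type} [AddCommMonoid K] {D : Type} [Category.{0} D]
  (S : PreFrobenioidData.{0} (SingleObj (ElemFrobenioidMonoid (Multiplicative K))) D)

/-- `Div` of a composite in `SingleObj F_K`: `Div(g ∘ f) = Div(g) + deg_Fr(g) · Div(f)` (multiplicatively).
[cite: MochizukiFrdI2008, Def. 1.1 (iii) p.20] -/
theorem singleObj_comp_div {X Y Z : SingleObj (ElemFrobenioidMonoid (Multiplicative K))} (f : X ⟶ Y)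
    (g : Y ⟶ Z) :
    ElemFrobenioidMonoid.div (f ≫ g) = (g : ElemFrobenioidMonoid (Multiplicative K)).div *
      (f : ElemFrobenioidMonoid (Multiplicative K)).div ^
        ((g : ElemFrobenioidMonoid (Multiplicative K)).degFr : ℕ) := rfl

/-- `deg_Fr` of a composite in `SingleObj F_K` is the product of the degrees.
[cite: MochizukiFrdI2008, Def. 1.1 (iii) p.20] -/
theorem singleObj_comp_degFr {X Y Z : SingleObj (ElemFrobenioidMonoid (Multiplicative K))} (f : X ⟶ Y)
    (g : Y ⟶ Z) :
    ElemFrobenioidMonoid.degFr (f ≫ g) = (g : ElemFrobenioidMonoid (Multiplicative K)).degFr *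
      (f : ElemFrobenioidMonoid (Multiplicative K)).degFr := rfl

/-- In `SingleObj F_K`, the arrow `(0, 1)` (trivial divisor, degree `1`) is an isomorphism — it is the
identity of `F_K`. [cite: MochizukiFrdI2008, Def. 1.1 (iii) p.20] -/
theorem singleObj_isIso_of {X Y : SingleObj (ElemFrobenioidMonoid (Multiplicative K))} (f : X ⟶ Y)
    (hv : (f : ElemFrobenioidMonoid (Multiplicative K)).div = 1)
    (hd : (f : ElemFrobenioidMonoid (Multiplicative K)).degFr = 1) : IsIso f := by
  obtain rfl : X = Y := Subsingleton.elim _ _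
  have : f = 𝟙 X := ElemFrobenioidMonoid.ext hv hd
  rw [this]
  infer_instance

/-- Pre-steps of `S` are the arrows of degree `1`. [cite: MochizukiFrdI2008, Def. 1.2 (iii) p.22] -/
theorem singleObj_isPreStep_iff
    (hdeg : ∀ {X Y : SingleObj (ElemFrobenioidMonoid (Multiplicative K))} (f : X ⟶ Y),
      S.degFr f = (f : ElemFrobenioidMonoid (Multiplicative K)).degFr)
    (hbase : ∀ {X Y : SingleObj (ElemFrobenioidMonoid (Multiplicative K))} (f : X ⟶ Y),
      IsIso (S.base.map f))
    {X Y : SingleObj (ElemFrobenioidMonoid (Multiplicative K))} (f : X ⟶ Y) :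
    S.IsPreStep f ↔ (f : ElemFrobenioidMonoid (Multiplicative K)).degFr = 1 := by
  show S.degFr f = 1 ∧ IsIso (S.base.map f) ↔ _
  rw [hdeg]
  exact ⟨fun h => h.1, fun h => ⟨h, hbase f⟩⟩

/-- Morphisms of Frobenius type of `S` are the arrows with zero divisor (every isometric pre-step
is an isomorphism, so co-angularity is automatic). [cite: MochizukiFrdI2008, Def. 1.2 (iii) p.22] -/
theorem singleObj_isFrobeniusType_iff
    (hdeg : ∀ {X Y : SingleObj (ElemFrobenioidMonoid (Multiplicative K))} (f : X ⟶ Y),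
      S.degFr f = (f : ElemFrobenioidMonoid (Multiplicative K)).degFr)
    (hbase : ∀ {X Y : SingleObj (ElemFrobenioidMonoid (Multiplicative K))} (f : X ⟶ Y),
      IsIso (S.base.map f))
    (hdiv : ∀ {X Y : SingleObj (ElemFrobenioidMonoid (Multiplicative K))} (f : X ⟶ Y),
      S.div f = 1 ↔ (f : ElemFrobenioidMonoid (Multiplicative K)).div = 1)
    {X Y : SingleObj (ElemFrobenioidMonoid (Multiplicative K))} (f : X ⟶ Y) :
    S.IsFrobeniusType f ↔ (f : ElemFrobenioidMonoid (Multiplicative K)).div = 1 := by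
  refine ⟨fun h => (hdiv f).mp h.1.2, fun h => ⟨⟨?_, (hdiv f).mpr h⟩, hbase f⟩⟩
  intro X' Y' γ β α _ _ hβ _
  have hβ1 := (singleObj_isPreStep_iff S hdeg hbase β).mp hβ.1
  exact singleObj_isIso_of β ((hdiv β).mp hβ.2) hβ1

/-- `S` is of isotropic type. [cite: MochizukiFrdI2008, Def. 1.2 (v) p.23] -/
theorem singleObj_isOfIsotropicType
    (hdeg : ∀ {X Y : SingleObj (ElemFrobenioidMonoid (Multiplicative K))} (f : X ⟶ Y),
      S.degFr f = (f : ElemFrobenioidMonoid (Multiplicative K)).degFr)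
    (hbase : ∀ {X Y : SingleObj (ElemFrobenioidMonoid (Multiplicative K))} (f : X ⟶ Y),
      IsIso (S.base.map f))
    (hdiv : ∀ {X Y : SingleObj (ElemFrobenioidMonoid (Multiplicative K))} (f : X ⟶ Y),
      S.div f = 1 ↔ (f : ElemFrobenioidMonoid (Multiplicative K)).div = 1) :
    S.IsOfIsotropicType :=
  ⟨fun _ _ φ hφ => singleObj_isIso_of φ ((hdiv φ).mp hφ.2)
    ((singleObj_isPreStep_iff S hdeg hbase φ).mp hφ.1)⟩

variable [Module ℚ≥0 K]

/-- An isomorphism of `SingleObj F_K` (for a sharp cone `K`) has trivial divisor and degree.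
[cite: MochizukiFrdI2008, Def. 1.1 (iii) p.20] -/
theorem singleObj_div_degFr_of_isIso (hK : ∀ a b : K, a + b = 0 → b = 0)
    {X Y : SingleObj (ElemFrobenioidMonoid (Multiplicative K))} (f : X ⟶ Y) (h : IsIso f) :
    (f : ElemFrobenioidMonoid (Multiplicative K)).div = 1 ∧
      (f : ElemFrobenioidMonoid (Multiplicative K)).degFr = 1 := by
  obtain ⟨g, hfg, -⟩ := h
  rw [SingleObj.comp_as_mul, SingleObj.id_as_one] at hfg
  have hd := congrArg ElemFrobenioidMonoid.degFr hfg
  have hv := congrArg ElemFrobenioidMonoid.div hfg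
  rw [ElemFrobenioidMonoid.mul_degFr, ElemFrobenioidMonoid.one_degFr] at hd
  rw [ElemFrobenioidMonoid.mul_div, ElemFrobenioidMonoid.one_div] at hv
  have hd' : (f : ElemFrobenioidMonoid (Multiplicative K)).degFr = 1 := by
    have h1 := congrArg PNat.val hd
    rw [PNat.mul_coe] at h1
    exact PNat.coe_eq_one_iff.mp (Nat.eq_one_of_mul_eq_one_left h1)
  refine ⟨?_, hd'⟩
  have hv' := congrArg Multiplicative.toAdd hv
  rw [toAdd_mul, toAdd_pow, toAdd_one] at hv'
  exact toAdd_eq_zero.mp (eq_zero_of_pnat_nsmul_eq_zero _ (hK _ _ hv'))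

/-- Steps of `S` are the arrows of degree `1` with non-zero divisor (sharp cone).
[cite: MochizukiFrdI2008, Def. 1.2 (iii) p.22] -/
theorem singleObj_isStep_iff (hK : ∀ a b : K, a + b = 0 → b = 0)
    (hdeg : ∀ {X Y : SingleObj (ElemFrobenioidMonoid (Multiplicative K))} (f : X ⟶ Y),
      S.degFr f = (f : ElemFrobenioidMonoid (Multiplicative K)).degFr)
    (hbase : ∀ {X Y : SingleObj (ElemFrobenioidMonoid (Multiplicative K))} (f : X ⟶ Y),
      IsIso (S.base.map f))
    {X Y : SingleObj (ElemFrobenioidMonoid (Multiplicative K))} (f : X ⟶ Y) :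
    S.IsStep f ↔ (f : ElemFrobenioidMonoid (Multiplicative K)).degFr = 1 ∧
      (f : ElemFrobenioidMonoid (Multiplicative K)).div ≠ 1 := by
  show S.IsPreStep f ∧ ¬ IsIso f ↔ _
  rw [singleObj_isPreStep_iff S hdeg hbase]
  refine ⟨fun h => ⟨h.1, fun hv => h.2 (singleObj_isIso_of f hv h.1)⟩,
    fun h => ⟨h.1, fun hi => h.2 (singleObj_div_degFr_of_isIso hK f hi).1⟩⟩

/-- `S` is of perfect type: `(0, n)` is of Frobenius type of degree `n`, and a pre-step `(a, 1)`
lifts uniquely along two such arrows, to `(n⁻¹ a, 1)` (`K` is uniquely divisible).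
[cite: MochizukiFrdI2008, Def. 1.2 (iv)/(v) p.23] -/
theorem singleObj_isOfPerfectType
    (hdeg : ∀ {X Y : SingleObj (ElemFrobenioidMonoid (Multiplicative K))} (f : X ⟶ Y),
      S.degFr f = (f : ElemFrobenioidMonoid (Multiplicative K)).degFr)
    (hbase : ∀ {X Y : SingleObj (ElemFrobenioidMonoid (Multiplicative K))} (f : X ⟶ Y),
      IsIso (S.base.map f))
    (hdiv : ∀ {X Y : SingleObj (ElemFrobenioidMonoid (Multiplicative K))} (f : X ⟶ Y),
      S.div f = 1 ↔ (f : ElemFrobenioidMonoid (Multiplicative K)).div = 1) :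
    S.IsOfPerfectType := by
  constructor
  intro A n
  refine ⟨fun B _ => ⟨B, (⟨1, n⟩ : ElemFrobenioidMonoid (Multiplicative K)),
    (singleObj_isFrobeniusType_iff S hdeg hbase hdiv _).mpr rfl, hdeg _⟩, ?_⟩
  intro B₁ B₁' B₂ B₂' φ₁ φ₂ _ _ hφ₁ hn₁ hφ₂ hn₂ ψ' hψ'
  obtain rfl : A = B₁ := Subsingleton.elim _ _
  obtain rfl : A = B₁' := Subsingleton.elim _ _
  obtain rfl : A = B₂ := Subsingleton.elim _ _
  obtain rfl : A = B₂' := Subsingleton.elim _ _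
  rw [singleObj_isFrobeniusType_iff S hdeg hbase hdiv] at hφ₁ hφ₂
  rw [hdeg] at hn₁ hn₂
  rw [singleObj_isPreStep_iff S hdeg hbase] at hψ'
  let ψ : ElemFrobenioidMonoid (Multiplicative K) :=
    ⟨Multiplicative.ofAdd ((n : ℚ≥0)⁻¹ •
      Multiplicative.toAdd (ψ' : ElemFrobenioidMonoid (Multiplicative K)).div), 1⟩
  refine ⟨ψ, ⟨(singleObj_isPreStep_iff S hdeg hbase _).mpr rfl, ?_⟩, ?_⟩
  · rw [SingleObj.comp_as_mul, SingleObj.comp_as_mul]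
    refine ElemFrobenioidMonoid.ext ?_ ?_
    · rw [ElemFrobenioidMonoid.mul_div, ElemFrobenioidMonoid.mul_div, hφ₁, hφ₂, hn₂, one_pow,
        mul_one, one_mul]
      show Multiplicative.ofAdd _ ^ (n : ℕ) = _
      rw [← ofAdd_nsmul, pnat_nsmul_inv_smul, ofAdd_toAdd]
    · rw [ElemFrobenioidMonoid.mul_degFr, ElemFrobenioidMonoid.mul_degFr, hn₂, hψ', hn₁]
      show n * 1 = 1 * n
      rw [mul_one, one_mul]
  · intro χ ⟨hχ, hcomp⟩
    rw [singleObj_isPreStep_iff S hdeg hbase] at hχ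
    rw [SingleObj.comp_as_mul, SingleObj.comp_as_mul] at hcomp
    have hv := congrArg ElemFrobenioidMonoid.div hcomp
    rw [ElemFrobenioidMonoid.mul_div, ElemFrobenioidMonoid.mul_div, hφ₁, hφ₂, hn₂, one_pow,
      mul_one, one_mul] at hv
    refine ElemFrobenioidMonoid.ext ?_ (hχ.trans rfl)
    show _ = Multiplicative.ofAdd _
    rw [← ofAdd_toAdd (ElemFrobenioidMonoid.div _), ← hv, toAdd_pow, inv_smul_pnat_nsmul]

/-- The Prop. 4.1 setting holds at the unique object with `α_n = (0, n)`: `S` is of perfect and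
isotropic type, the object is Div-Frobenius-trivial via `n ↦ (0, n)`, and each `(0, n)` is a
Div-identity endomorphism of Frobenius type of degree `n`. [cite: MochizukiFrdI2008, Prop. 4.1 p.75] -/
theorem singleObj_exists_prop41Setting
    (hdeg : ∀ {X Y : SingleObj (ElemFrobenioidMonoid (Multiplicative K))} (f : X ⟶ Y),
      S.degFr f = (f : ElemFrobenioidMonoid (Multiplicative K)).degFr)
    (hbase : ∀ {X Y : SingleObj (ElemFrobenioidMonoid (Multiplicative K))} (f : X ⟶ Y),
      IsIso (S.base.map f))
    (hdiv : ∀ {X Y : SingleObj (ElemFrobenioidMonoid (Multiplicative K))} (f : X ⟶ Y),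
      S.div f = 1 ↔ (f : ElemFrobenioidMonoid (Multiplicative K)).div = 1)
    (hpull : ∀ {X : SingleObj (ElemFrobenioidMonoid (Multiplicative K))} (f : X ⟶ X)
      (x : S.Mon (S.base.obj X)), S.pull (S.base.map f) x = x)
    (A : SingleObj (ElemFrobenioidMonoid (Multiplicative K))) :
    ∃ α : ℕ+ → End A, S.Prop41Setting A α ∧
      ∀ n, (α n : ElemFrobenioidMonoid (Multiplicative K)) = ⟨1, n⟩ := by
  obtain rfl : A = SingleObj.star _ := Subsingleton.elim _ _
  let ζ₀ : ℕ+ →* ElemFrobenioidMonoid (Multiplicative K) :=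
    { toFun := fun n => ⟨1, n⟩
      map_one' := rfl
      map_mul' := fun m n => ElemFrobenioidMonoid.ext (by
        rw [ElemFrobenioidMonoid.mul_div, one_pow, mul_one]) rfl }
  let ζ : ℕ+ →* End (SingleObj.star (ElemFrobenioidMonoid (Multiplicative K))) :=
    (SingleObj.toEnd _).toMonoidHom.comp ζ₀
  have hζ : ∀ n, (ζ n : ElemFrobenioidMonoid (Multiplicative K)) = ⟨1, n⟩ := fun n => rfl
  have hFr : ∀ n, S.IsFrobeniusType (ζ n : SingleObj.star _ ⟶ SingleObj.star _) := fun n =>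
    (singleObj_isFrobeniusType_iff S hdeg hbase hdiv _).mpr rfl
  refine ⟨fun n => ζ n, ⟨singleObj_isOfPerfectType S hdeg hbase hdiv,
    singleObj_isOfIsotropicType S hdeg hbase hdiv, ⟨ζ, fun n => ⟨hdeg _, fun x => hpull _ x, hFr n⟩⟩,
    fun n => ⟨fun x => hpull _ x, hFr n, hdeg _⟩⟩, hζ⟩

end Generic

end Literature.AlgebraicGeometry.Frobenioids
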